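import Summits.CriticalPhenomena.PercolationContinuityZ3.Theorems.PercNearOneGluingNoHeavyRsw3SetToSetAiming
import Summits.CriticalPhenomena.PercolationContinuityZ3.Theorems.PercNearOneGluingNoHeavyRsw3SetToSetTwoPointCone
import HarnessLib

/-!
# RSW3 lane (P2, gen 18): (A2)□ at `p_c(ℤ^d)` ⇒ `τ_{p_c}(0, x) ≍ π_{p_c}(‖x‖_∞)²` FOR EVERY `x ≠ 0` — Kesten's two-point/one-arm
# identity (`d − 2 + η = 2/ρ`) in all directions, and the summed (hyperscaling) inequality

builds on p205010 (kernel theorem, internal audit signed; external expert review pending) — NOT used in this file.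

Cell `prim-rsw3`, prover seat `prim-rsw3-p2` (gen 18), memo `run/shared/lean/prim/rsw3/P2-RSWLITE.md` §25.
Support file (`--supports stmt-CriticalPhenomena-4575`); no definitions, no named facts, no sorries.

Gen 17 proved the lower bound `c·π(|x_i|)² ≤ τ(0,x)` under Basu–Sapozhnikov's (A2)□ for `x` on an axis (`…TwoPointOneArm`) and in
the `½`-cones (`…TwoPointCone`).  Here it is proved for EVERY `x ≠ 0`, with `|x_i| = ‖x‖_∞`
(`exists_mul_sq_oneArmProb_le_tau_of_setToSetQuasiMultAspectAt`).  PROOF.  Let `N = ‖x‖_∞ = ε x_i`, `m = ⌊N/(L+2)⌋`,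
`Z = Λ(4N)`.  The TRANSLATED (A2)□ at centre `x` (gen 16, `setToSetQuasiMultAspectAt_shift`) with inner set `{x}` and outer set
`{0}` (`N > Lm`) gives `ϰ · P[{x} ↔ ∂ⁱⁿΛ_x(sm) in Z] · P[{0} ↔ ∂ⁱⁿΛ_x(sm) in Z] ≤ P[{x} ↔ {0} in Z] ≤ τ(0,x)`.  The first factor is
`≥ π(sm) ≥ π(N)`.  The second is `≥ P[Λ_x(m) ↔ {0} in Z]` (first entry into `Λ_x(sm)`), and THAT is `≥ c · π(N)` by the AIMING
LEMMA of `…Rsw3SetToSetAiming.lean` with target `t = x` in the signed direction `(i, ε)` and `ρ = (L+2)m ≤ N`: the arm from `0`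
through the face `{v_i = ε ρ}` of `Λ(ρ)` is pigeonholed into a grid ball on that face and dragged to `Λ_x(m)` by the (A2)□ chain,
all centres keeping `ε c_i ≥ (L+1)m`.  Small `‖x‖` is covered by `p^{‖x‖₁} ≤ τ(0,x)`.  With gen 17's every-`p` upper bound
`τ(0,x) ≤ π(⌊(|x_i|−1)/2⌋)²` and one-arm doubling (a consequence of (A2)□), `τ(0,x) ≍ π(‖x‖_∞)²` for all `x ≠ 0`
(`exists_tau_two_sided_of_setToSetQuasiMultAspectAt`); box form `∀ x ∈ Λ(n) ∖ {0}: c·π(n)² ≤ τ(0,x)` and the summed LOWER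
HYPERSCALING INEQUALITY `c·(2n+1)^d·π(n)² ≤ Σ_{z ∈ Λ(n)} τ(0,z) = E|C(0) ∩ Λ(n)|` under (A2)□ (`…_sum_tau_…`; the lead's V165 derives
the same inequality from the annulus-blocking postulate `X_B`).

References: H. Kesten, *Scaling relations for 2D-percolation*, Comm. Math. Phys. 109 (1987) 109–156 [Kesten1987]; D. Basu,
A. Sapozhnikov, ECP 22 (2017) no. 26, §1 (A2) [BasuSapozhnikov2017ECP]; C. Borgs, J. Chayes, H. Kesten, J. Spencer, RandomСтрук. Alg.
15 (1999) [BorgsChayesKestenSpencer1999]; G. Grimmett, *Percolation* (1999), §9.1 (scaling relations) [GrimmettPercolation1999]. [folklore]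
-/

noncomputable section

namespace Summit.CriticalPhenomena.PercolationContinuityZ3.Theorems

namespace Rsw3

open MeasureTheory Literature.Probability.LatticeModels Literature.Probability.Percolation
open SurfaceTension Crossing SimpleGraph

variable {d : ℕ}

/-! ## Two small bookkeeping lemmas -/

/-- The ball of radius `0` is its centre. [folklore] -/
theorem ball_radius_zero (c : Site d) : GM.ball c 0 = {c} := by
  ext z
  rw [GM.mem_ball, Finset.mem_singleton]
  constructor
  · intro h
    funext j
    have := h j
    push_cast at this
    omega
  · intro h j
    subst h
    simp

/-- `P_p[{x} ↔ {0} in Z] ≤ τ_p(0, x)`. [folklore] -/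
theorem real_openCrossing_singleton_le_tau (p : unitInterval) (Z : Finset (Site d)) (x : Site d) :
    (bondPercolation (zdGraph d) p).real
        (openCrossing (↑Z : Set (Site d)) ↑({x} : Finset (Site d)) ↑({(0 : Site d)} : Finset (Site d))) ≤
      tau d p 0 x := by
  rw [tau_comm, tau_def]
  refine measureReal_mono (fun ω hω => ?_) (measure_ne_top _ _)
  obtain ⟨x₀, hx₀, y, hy, hxy⟩ := hω
  rw [Finset.coe_singleton, Set.mem_singleton_iff] at hx₀ hy
  subst hx₀; subst hy
  exact openConnIn_subset_openConn _ _ _ hxy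

/-! ## The finite-volume theorem in every direction -/

/-- **(A2)□ at `p_c(ℤ^d)` ⇒ `c · π_{p_c}(‖x‖_∞)² ≤ P_{p_c}[x ↔ 0 in Λ(4‖x‖_∞)]` for every `x` with `‖x‖_∞ ≥ L + 2`**
(`d ≥ 2`, `2 ≤ s ≤ L`, `ϰ > 0`; `i` any coordinate of maximal modulus, `|x_i| = ‖x‖_∞`): the FINITE-VOLUME lower half of
Kesten's identity `τ ≍ π²` in all directions — translated (A2)□ at centre `x` with inner set `{x}` and outer set `{0}`, first factor
`π(sm)`, second factor by first entry and the AIMING LEMMA (gen 18).  The connection is produced inside the box `Λ(4‖x‖_∞)`.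
[cite: Kesten1987, §1 (scaling relations)] [cite: BasuSapozhnikov2017ECP, §1 assumption (A2)] -/
theorem exists_mul_sq_oneArmProb_le_real_openCrossing_of_setToSetQuasiMultAspectAt (hd : 2 ≤ d) {s L : ℕ} {ϰ : ℝ}
    (h : SetToSetQuasiMultAspectAt d (criticalProbI d) s L ϰ) (hϰ : 0 < ϰ) (hs : 2 ≤ s) (hsL : s ≤ L) :
    ∃ c : ℝ, 0 < c ∧ ∀ (x : Site d) (i : Fin d), (∀ j, (x j).natAbs ≤ (x i).natAbs) → L + 2 ≤ (x i).natAbs →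
      c * oneArmProb d (criticalProbI d) (x i).natAbs ^ 2 ≤ (bondPercolation (zdGraph d) (criticalProbI d)).real
        (openCrossing (↑(box d (4 * (x i).natAbs)) : Set (Site d)) ↑({x} : Finset (Site d))
          ↑({(0 : Site d)} : Finset (Site d))) := by
  classical
  have hd1 : 1 ≤ d := by omega
  set pc : unitInterval := criticalProbI d with hpcdef
  have hdpos : (0 : ℝ) < d := by exact_mod_cast (show 0 < d by omega)
  have hd0 : (0 : ℝ) < 2 * d := by linarith
  -- the annulus window at aspect `s`
  set u₀ : ℝ := (2 * (d : ℝ))⁻¹ * ((4 * (s : ℝ)) ^ (d - 1))⁻¹ with hu₀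
  have hu₀pos : 0 < u₀ := by
    have : (0 : ℝ) < s := by exact_mod_cast (show 0 < s by omega)
    positivity
  have hu : ∀ m, 1 ≤ m → u₀ ≤ (bondPercolation (zdGraph d) pc).real (boxCrossing d m (s * m)) :=
    fun m hm => le_real_boxCrossing_mul_criticalProbI hd (by omega) hm
  -- constants
  obtain ⟨a, ha⟩ : ∃ a : ℕ, a = L + 2 := ⟨_, rfl⟩
  obtain ⟨K, hK⟩ : ∃ K : ℕ, K = 3 * L + 7 := ⟨_, rfl⟩
  obtain ⟨A, hA⟩ : ∃ A : ℝ, A = (2 * (a : ℝ) + 1) ^ d := ⟨_, rfl⟩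
  have hApos : 0 < A := by rw [hA]; positivity
  obtain ⟨c₁, hc₁⟩ : ∃ c₁ : ℝ, c₁ = ϰ * ((ϰ * u₀) ^ K / (2 * d * A)) := ⟨_, rfl⟩
  have hc₁pos : 0 < c₁ := by rw [hc₁]; positivity
  refine ⟨c₁, hc₁pos, fun x i hmax hsmall => ?_⟩
  obtain ⟨N, hN⟩ : ∃ N : ℕ, N = (x i).natAbs := ⟨_, rfl⟩
  rw [← hN] at hmax hsmall ⊢
  have hπ1 : oneArmProb d pc N ≤ 1 := measureReal_le_one
  have hπ0 : 0 ≤ oneArmProb d pc N := measureReal_nonneg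
  · -- the scale `m = ⌊N/(L+2)⌋ ≥ 1`, `ρ = (L+2)m ≤ N < ρ + L + 2`
    obtain ⟨m, hm⟩ : ∃ m : ℕ, m = N / (L + 2) := ⟨_, rfl⟩
    have hL2 : 0 < L + 2 := by omega
    have hm1 : 1 ≤ m := by rw [hm]; exact (Nat.le_div_iff_mul_le hL2).2 (by omega)
    obtain ⟨ρ, hρ⟩ : ∃ ρ : ℕ, ρ = (L + 2) * m := ⟨_, rfl⟩
    have hdm := Nat.div_add_mod N (L + 2)
    have hml := Nat.mod_lt N hL2
    rw [← hm, ← hρ] at hdm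
    have hρN : ρ ≤ N := by omega
    have hNρ : N < ρ + (L + 2) := by omega
    have hρL : L + 2 ≤ ρ := by rw [hρ]; exact Nat.le_mul_of_pos_right _ (by omega)
    -- products as atoms
    obtain ⟨Lm, hLm⟩ : ∃ P : ℕ, P = L * m := ⟨_, rfl⟩
    obtain ⟨sm, hsm⟩ : ∃ P : ℕ, P = s * m := ⟨_, rfl⟩
    have hsmLm : sm ≤ Lm := by rw [hsm, hLm]; exact Nat.mul_le_mul_right m hsL
    have hmsm : m + m ≤ sm := by rw [hsm]; nlinarith
    have hLmρ : Lm + 2 * m = ρ := by rw [hLm, hρ]; ring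
    have hL1m : (L + 1) * m + m = ρ := by rw [hρ]; ring
    have hL3m : (L + 3) * m = ρ + m := by rw [hρ]; ring
    have ham : (a + 1) * m = (L + 3) * m := by rw [ha]
    have hKm : K * m = 2 * ρ + (L + 3) * m := by rw [hK, hρ]; ring
    have hsmN : sm < N := by omega
    have hLmN : Lm < N := by omega
    have hxj : ∀ j, (x j).natAbs ≤ N := hmax
    -- the sign of `x i`
    obtain ⟨ε, hε⟩ : ∃ ε : ℤˣ, (ε : ℤ) * x i = N := by
      rcases le_or_gt 0 (x i) with h0 | h0
      · exact ⟨1, by rw [Units.val_one, one_mul, hN]; omega⟩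
      · exact ⟨-1, by rw [Units.val_neg, Units.val_one, hN]; omega⟩
    -- the region `Z = Λ(4N)` and the balls around `x`
    set Z : Finset (Site d) := box d (4 * N) with hZ
    have h0ball : ∀ r : ℕ, r < N → (0 : Site d) ∉ GM.ball x r := by
      intro r hr h0
      have h1 := (GM.mem_ball.1 h0) i
      simp only [Pi.zero_apply, zero_sub] at h1
      omega
    have hballZ : GM.ball x (L * m) ⊆ Z :=
      ball_subset_box_of_natAbs_le fun j => by rw [← hLm]; have := hxj j; omega
    have hsmZ : GM.ball x (s * m) ⊆ Z :=
      (ball_subset_ball_of_le x (by rw [← hsm, ← hLm]; exact hsmLm)).trans hballZ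
    have hxZ : x ∈ Z := by rw [hZ, mem_box_iff_natAbs]; intro j; have := hxj j; omega
    -- AIMING at `t = x`
    have haim := pow_mul_oneArmProb_div_le_real_openCrossing_ball hd1 h hϰ.le hs hsL hm1 i ε
      (ρ := ρ) (a := a) (K := K) (R := 4 * N) (by rw [hρ]) (by rw [hρ, ha]) x
      (by rw [hε]; exact_mod_cast (show (L + 1) * m ≤ N by omega))
      (fun j => by rw [ham, hKm]; have := hxj j; omega)
      (fun j => by rw [← hLm]; have := hxj j; omega) (by rw [ham, ← hLm]; omega) (le_refl Z)
    -- (A2)□ translated to the centre `x`, inner set `{x}`, outer set `{0}`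
    have hZ' : GM.ball x (L * m) \ GM.ball x (m - 1) ⊆ Z := Finset.sdiff_subset.trans hballZ
    have hX' : ({x} : Finset (Site d)) ⊆ Z ∩ GM.ball x m := by
      rw [Finset.singleton_subset_iff, Finset.mem_inter]; exact ⟨hxZ, GM.self_mem_ball x m⟩
    have hY' : ({(0 : Site d)} : Finset (Site d)) ⊆ Z \ GM.ball x (L * m) := by
      rw [Finset.singleton_subset_iff, Finset.mem_sdiff]
      exact ⟨zero_mem_box d _, h0ball (L * m) (by rw [← hLm]; exact hLmN)⟩
    have hA2 := setToSetQuasiMultAspectAt_shift h x hm1 Z hZ' {x} hX' {0} hY'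
    -- first factor `≥ π(N)`
    have hF1 : oneArmProb d pc N ≤ (bondPercolation (zdGraph d) pc).real
        (openCrossing (↑Z : Set (Site d)) ↑({x} : Finset (Site d)) ↑(innerBoundary (zdGraph d) (GM.ball x (s * m)))) := by
      have h1 : oneArmProb d pc N ≤ oneArmProb d pc (s * m) :=
        DCT16.real_siteToBoundary_antitone pc (by rw [← hsm]; exact hsmN.le)
      have h2 := Quant.oneArmProb_le_real_boxCrossing (d := d) pc (s * m)
      have h3 := real_boxCrossing_le_real_openCrossing_ball pc x 0 (s * m) Z hsmZ
      rw [ball_radius_zero] at h3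
      exact h1.trans (h2.trans h3)
    -- second factor `≥ P[Λ_x(m) ↔ {0} in Z] ≥ (ϰu₀)^K π(N) / (2dA)`
    have hF2 : (bondPercolation (zdGraph d) pc).real
          (openCrossing (↑Z : Set (Site d)) ↑(GM.ball x m) ↑({(0 : Site d)} : Finset (Site d))) ≤
        (bondPercolation (zdGraph d) pc).real (openCrossing (↑Z : Set (Site d)) ↑({(0 : Site d)} : Finset (Site d))
          ↑(innerBoundary (zdGraph d) (GM.ball x (s * m)))) :=
      real_openCrossing_ball_le_real_openCrossing_innerBoundary pc
        (ball_subset_ball_of_le x (show m ≤ s * m by rw [← hsm]; omega))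
        (fun y hy => by rw [Finset.mem_singleton] at hy; subst hy; exact h0ball (s * m) (by rw [← hsm]; exact hsmN))
    have hq : ϰ * u₀ ≤ ϰ * (bondPercolation (zdGraph d) pc).real (boxCrossing d m (s * m)) :=
      mul_le_mul_of_nonneg_left (hu m hm1) hϰ.le
    have hqK : (ϰ * u₀) ^ K ≤ (ϰ * (bondPercolation (zdGraph d) pc).real (boxCrossing d m (s * m))) ^ K :=
      pow_le_pow_left₀ (by positivity) hq K
    have hπρ : oneArmProb d pc N ≤ oneArmProb d pc ρ := DCT16.real_siteToBoundary_antitone pc hρN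
    have hlow2 : (ϰ * u₀) ^ K * (oneArmProb d pc N / (2 * d)) ≤ A * (bondPercolation (zdGraph d) pc).real
        (openCrossing (↑Z : Set (Site d)) ↑(GM.ball x m) ↑({(0 : Site d)} : Finset (Site d))) := by
      rw [hA]
      calc (ϰ * u₀) ^ K * (oneArmProb d pc N / (2 * d))
          ≤ (ϰ * (bondPercolation (zdGraph d) pc).real (boxCrossing d m (s * m))) ^ K * (oneArmProb d pc ρ / (2 * d)) :=
            mul_le_mul hqK (div_le_div_of_nonneg_right hπρ hd0.le) (div_nonneg hπ0 hd0.le)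
              (pow_nonneg (mul_nonneg hϰ.le measureReal_nonneg) K)
        _ ≤ _ := haim
    have hP2 : (ϰ * u₀) ^ K * (oneArmProb d pc N / (2 * d)) / A ≤ (bondPercolation (zdGraph d) pc).real
        (openCrossing (↑Z : Set (Site d)) ↑(GM.ball x m) ↑({(0 : Site d)} : Finset (Site d))) := by
      rw [div_le_iff₀ hApos]; linarith [hlow2]
    have hP2' := hP2.trans hF2
    have hnn : 0 ≤ (ϰ * u₀) ^ K * (oneArmProb d pc N / (2 * d)) / A :=
      div_nonneg (mul_nonneg (pow_nonneg (mul_nonneg hϰ.le hu₀pos.le) K) (div_nonneg hπ0 hd0.le)) hApos.le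
    -- assemble
    calc c₁ * oneArmProb d pc N ^ 2
        = ϰ * (oneArmProb d pc N * ((ϰ * u₀) ^ K * (oneArmProb d pc N / (2 * d)) / A)) := by
          rw [hc₁]; field_simp
      _ ≤ ϰ * ((bondPercolation (zdGraph d) pc).real
              (openCrossing (↑Z : Set (Site d)) ↑({x} : Finset (Site d)) ↑(innerBoundary (zdGraph d) (GM.ball x (s * m)))) *
            (bondPercolation (zdGraph d) pc).real (openCrossing (↑Z : Set (Site d)) ↑({(0 : Site d)} : Finset (Site d))
              ↑(innerBoundary (zdGraph d) (GM.ball x (s * m))))) :=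
          mul_le_mul_of_nonneg_left (mul_le_mul hF1 hP2' hnn measureReal_nonneg) hϰ.le
      _ ≤ (bondPercolation (zdGraph d) pc).real
            (openCrossing (↑Z : Set (Site d)) ↑({x} : Finset (Site d)) ↑({(0 : Site d)} : Finset (Site d))) := hA2

/-! ## The theorem for `τ`, every `x ≠ 0` -/

/-- **(A2)□ at `p_c(ℤ^d)` ⇒ `c · π_{p_c}(‖x‖_∞)² ≤ τ_{p_c}(0, x)` for EVERY `x ≠ 0`** (`d ≥ 2`, `2 ≤ s ≤ L`, `ϰ > 0`): under
`SetToSetQuasiMultAspectAt d p_c s L ϰ` there is `c > 0` such that for every `x` and every coordinate `i` of maximal modulus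
(`|x_j| ≤ |x_i|` for all `j`, `|x_i| ≥ 1`): `c · oneArmProb d p_c |x_i| ^ 2 ≤ tau d p_c 0 x`.  The lower half of Kesten's identity
`τ(0,x) ≍ π(‖x‖)²` (`d − 2 + η = 2/ρ`) in all directions (gen 17: axes and `½`-cones); the diagonal directions are reached by
AIMING the arm (gen 18).  Small `‖x‖ < L + 2` by `p^{‖x‖₁} ≤ τ(0,x)`.
[cite: Kesten1987, §1 (scaling relations)] [cite: BasuSapozhnikov2017ECP, §1 assumption (A2)] -/
theorem exists_mul_sq_oneArmProb_le_tau_of_setToSetQuasiMultAspectAt (hd : 2 ≤ d) {s L : ℕ} {ϰ : ℝ}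
    (h : SetToSetQuasiMultAspectAt d (criticalProbI d) s L ϰ) (hϰ : 0 < ϰ) (hs : 2 ≤ s) (hsL : s ≤ L) :
    ∃ c : ℝ, 0 < c ∧ ∀ (x : Site d) (i : Fin d), (∀ j, (x j).natAbs ≤ (x i).natAbs) → 1 ≤ (x i).natAbs →
      c * oneArmProb d (criticalProbI d) (x i).natAbs ^ 2 ≤ tau d (criticalProbI d) 0 x := by
  classical
  have hd1 : 1 ≤ d := by omega
  set pc : unitInterval := criticalProbI d with hpcdef
  have hpc : 0 < (pc : ℝ) := by rw [hpcdef, coe_criticalProbI]; exact criticalProb_zd_pos d hd1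
  have hpc1 : (pc : ℝ) ≤ 1 := pc.2.2
  obtain ⟨c₁, hc₁pos, hbig⟩ := exists_mul_sq_oneArmProb_le_real_openCrossing_of_setToSetQuasiMultAspectAt hd h hϰ hs hsL
  obtain ⟨N₁, hN₁⟩ : ∃ N₁ : ℕ, N₁ = d * (L + 1) := ⟨_, rfl⟩
  refine ⟨min ((pc : ℝ) ^ N₁) c₁, lt_min (pow_pos hpc _) hc₁pos, fun x i hmax hxi => ?_⟩
  obtain ⟨N, hN⟩ : ∃ N : ℕ, N = (x i).natAbs := ⟨_, rfl⟩
  have hπ1 : oneArmProb d pc N ≤ 1 := measureReal_le_one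
  have hπ0 : 0 ≤ oneArmProb d pc N := measureReal_nonneg
  by_cases hsmall : N < L + 2
  · -- small `‖x‖`: `p^{‖x‖₁} ≤ τ(0,x)` and `‖x‖₁ ≤ d N ≤ N₁`
    rw [← hN] at hmax hxi ⊢
    have hsum : ∑ k, (x k).natAbs ≤ N₁ := by
      calc ∑ k, (x k).natAbs ≤ ∑ _k : Fin d, N := Finset.sum_le_sum fun k _ => hmax k
        _ = d * N := by simp
        _ ≤ N₁ := by rw [hN₁]; exact Nat.mul_le_mul_left d (by omega)
    calc min ((pc : ℝ) ^ N₁) c₁ * oneArmProb d pc N ^ 2 ≤ (pc : ℝ) ^ N₁ * 1 :=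
          mul_le_mul (min_le_left _ _) (by nlinarith) (sq_nonneg _) (pow_nonneg hpc.le _)
      _ ≤ (pc : ℝ) ^ (∑ k, (x k).natAbs) := by rw [mul_one]; exact pow_le_pow_of_le_one hpc.le hpc1 hsum
      _ ≤ tau d pc 0 x := pow_norm1_le_tau pc x
  · push Not at hsmall
    rw [hN] at hsmall
    calc min ((pc : ℝ) ^ N₁) c₁ * oneArmProb d pc (x i).natAbs ^ 2 ≤ c₁ * oneArmProb d pc (x i).natAbs ^ 2 :=
          mul_le_mul_of_nonneg_right (min_le_right _ _) (sq_nonneg _)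
      _ ≤ _ := hbig x i hmax hsmall
      _ ≤ tau d pc 0 x := real_openCrossing_singleton_le_tau pc _ x

/-- **(A2)□ ⇒ `τ ≍ π²` in every direction** (`p_c(ℤ^d)`, `d ≥ 2`, `2 ≤ s ≤ L`, `ϰ > 0`): `0 < c ≤ C` with
`c · π(|x_i|)² ≤ τ(0, x) ≤ C · π(|x_i|)²` for every `x` and every coordinate `i` of maximal modulus `|x_i| = ‖x‖_∞ ≥ 1`
(upper half at every `p` by disjoint-ball independence, `tau_le_sq_oneArmProb_of_lt`, plus one-arm doubling from (A2)□).
[cite: Kesten1987, §1 (scaling relations)] [cite: BasuSapozhnikov2017ECP, §1 assumption (A2)] -/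
theorem exists_tau_two_sided_of_setToSetQuasiMultAspectAt (hd : 2 ≤ d) {s L : ℕ} {ϰ : ℝ}
    (h : SetToSetQuasiMultAspectAt d (criticalProbI d) s L ϰ) (hϰ : 0 < ϰ) (hs : 2 ≤ s) (hsL : s ≤ L) :
    ∃ c C : ℝ, 0 < c ∧ 0 < C ∧ ∀ (x : Site d) (i : Fin d), (∀ j, (x j).natAbs ≤ (x i).natAbs) → 1 ≤ (x i).natAbs →
      c * oneArmProb d (criticalProbI d) (x i).natAbs ^ 2 ≤ tau d (criticalProbI d) 0 x ∧
        tau d (criticalProbI d) 0 x ≤ C * oneArmProb d (criticalProbI d) (x i).natAbs ^ 2 := by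
  have hd1 : 1 ≤ d := by omega
  obtain ⟨c, hc, hlow⟩ := exists_mul_sq_oneArmProb_le_tau_of_setToSetQuasiMultAspectAt hd h hϰ hs hsL
  set pc : unitInterval := criticalProbI d with hpcdef
  obtain ⟨c₀, hc₀, hQM⟩ := oneArmQuasiMultAt_of_setToSetQuasiMultAspectAt hd hs hsL hϰ h
  have hD := oneArmDoublingAt_of_oneArmQuasiMultAt hd hc₀.le hQM
  set c₁ : ℝ := c₀ * ((85 : ℝ) ^ d)⁻¹ with hc₁
  have hc₁pos : 0 < c₁ := mul_pos hc₀ (inv_pos.2 (pow_pos (by norm_num) d))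
  have hpc : 0 < (pc : ℝ) := by rw [hpcdef, coe_criticalProbI]; exact criticalProb_zd_pos d hd1
  have hπ2 : 0 < oneArmProb d pc 2 := (pow_pos hpc 2).trans_le (DKT20.pow_le_real_siteToBoundary hd1 pc 2)
  have hi2 : 0 < (oneArmProb d pc 2 ^ 2)⁻¹ := inv_pos.2 (pow_pos hπ2 2)
  have hic : 0 ≤ ((c₁ ^ 2)⁻¹) ^ 2 := pow_nonneg (inv_nonneg.2 (sq_nonneg c₁)) 2
  refine ⟨c, ((c₁ ^ 2)⁻¹) ^ 2 + (oneArmProb d pc 2 ^ 2)⁻¹, hc, add_pos_of_nonneg_of_pos hic hi2,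
    fun x i hmax hxi => ⟨hlow x i hmax hxi, ?_⟩⟩
  obtain ⟨n, hn⟩ : ∃ n : ℕ, n = (x i).natAbs := ⟨_, rfl⟩
  rw [← hn] at hxi ⊢
  have hτ1 : tau d pc 0 x ≤ 1 := measureReal_le_one
  have hπn0 : 0 ≤ oneArmProb d pc n := measureReal_nonneg
  have hA0 : 0 ≤ ((c₁ ^ 2)⁻¹) ^ 2 * oneArmProb d pc n ^ 2 := mul_nonneg hic (sq_nonneg _)
  have hB0 : 0 ≤ (oneArmProb d pc 2 ^ 2)⁻¹ * oneArmProb d pc n ^ 2 := mul_nonneg hi2.le (sq_nonneg _)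
  by_cases hn2 : n ≤ 2
  · have hmono : oneArmProb d pc 2 ≤ oneArmProb d pc n := DCT16.real_siteToBoundary_antitone pc hn2
    have hratio : 1 ≤ (oneArmProb d pc 2 ^ 2)⁻¹ * oneArmProb d pc n ^ 2 := by
      rw [inv_mul_eq_div, one_le_div (pow_pos hπ2 2)]
      exact pow_le_pow_left₀ hπ2.le hmono 2
    calc tau d pc 0 x ≤ 1 := hτ1
      _ ≤ (oneArmProb d pc 2 ^ 2)⁻¹ * oneArmProb d pc n ^ 2 := hratio
      _ ≤ (((c₁ ^ 2)⁻¹) ^ 2 + (oneArmProb d pc 2 ^ 2)⁻¹) * oneArmProb d pc n ^ 2 := by rw [add_mul]; linarith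
  · push Not at hn2
    obtain ⟨k, hk⟩ : ∃ k : ℕ, k = (n - 1) / 2 := ⟨_, rfl⟩
    have hk1 : 1 ≤ k := by omega
    have h2k : 2 * k < n := by omega
    have hn4k : n ≤ 4 * k := by omega
    have hτ : tau d pc 0 x ≤ oneArmProb d pc k ^ 2 := tau_le_sq_oneArmProb_of_lt pc (i := i) (by rw [← hn]; exact h2k)
    have hd1' := hD k hk1
    have hd2' := hD (2 * k) (by omega)
    rw [show 2 * (2 * k) = 4 * k by ring] at hd2'
    have hmono : oneArmProb d pc (4 * k) ≤ oneArmProb d pc n := DCT16.real_siteToBoundary_antitone pc hn4k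
    have hπk0 : 0 ≤ oneArmProb d pc k := measureReal_nonneg
    have hchain : c₁ ^ 2 * oneArmProb d pc k ≤ oneArmProb d pc n := by
      calc c₁ ^ 2 * oneArmProb d pc k = c₁ * (c₁ * oneArmProb d pc k) := by ring
        _ ≤ c₁ * oneArmProb d pc (2 * k) := mul_le_mul_of_nonneg_left hd1' hc₁pos.le
        _ ≤ oneArmProb d pc (4 * k) := hd2'
        _ ≤ oneArmProb d pc n := hmono
    have hπk : oneArmProb d pc k ≤ (c₁ ^ 2)⁻¹ * oneArmProb d pc n := by
      rw [inv_mul_eq_div, le_div_iff₀ (pow_pos hc₁pos 2), mul_comm]; exact hchain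
    calc tau d pc 0 x ≤ oneArmProb d pc k ^ 2 := hτ
      _ ≤ ((c₁ ^ 2)⁻¹ * oneArmProb d pc n) ^ 2 := pow_le_pow_left₀ hπk0 hπk 2
      _ = ((c₁ ^ 2)⁻¹) ^ 2 * oneArmProb d pc n ^ 2 := by ring
      _ ≤ (((c₁ ^ 2)⁻¹) ^ 2 + (oneArmProb d pc 2 ^ 2)⁻¹) * oneArmProb d pc n ^ 2 := by rw [add_mul]; linarith

/-! ## Box form and the summed (hyperscaling) inequality -/

/-- **Box form**: under (A2)□ at `p_c(ℤ^d)` (`d ≥ 2`, `2 ≤ s ≤ L`, `ϰ > 0`) there is `c > 0` with `c · π(n)² ≤ τ(0, x)` for every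
`n` and every `x ∈ Λ(n) ∖ {0}` (the one-arm probability is non-increasing, `π(n) ≤ π(‖x‖_∞)`).
[cite: Kesten1987, §1 (scaling relations)] [cite: BasuSapozhnikov2017ECP, §1 assumption (A2)] -/
theorem exists_mul_sq_oneArmProb_le_tau_box_of_setToSetQuasiMultAspectAt (hd : 2 ≤ d) {s L : ℕ} {ϰ : ℝ}
    (h : SetToSetQuasiMultAspectAt d (criticalProbI d) s L ϰ) (hϰ : 0 < ϰ) (hs : 2 ≤ s) (hsL : s ≤ L) :
    ∃ c : ℝ, 0 < c ∧ ∀ (n : ℕ) (x : Site d), x ∈ box d n → x ≠ 0 →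
      c * oneArmProb d (criticalProbI d) n ^ 2 ≤ tau d (criticalProbI d) 0 x := by
  obtain ⟨c, hc, hmain⟩ := exists_mul_sq_oneArmProb_le_tau_of_setToSetQuasiMultAspectAt hd h hϰ hs hsL
  refine ⟨c, hc, fun n x hx hx0 => ?_⟩
  have hne : (Finset.univ : Finset (Fin d)).Nonempty := Finset.univ_nonempty_iff.2 ⟨⟨0, by omega⟩⟩
  obtain ⟨i, -, hi⟩ := Finset.exists_max_image Finset.univ (fun j => (x j).natAbs) hne
  have hmax : ∀ j, (x j).natAbs ≤ (x i).natAbs := fun j => hi j (Finset.mem_univ j)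
  have hxi : 1 ≤ (x i).natAbs := by
    by_contra h0
    push Not at h0
    apply hx0
    funext j
    have := hmax j
    simp only [Pi.zero_apply]
    omega
  have hxin : (x i).natAbs ≤ n := (mem_box_iff_natAbs.1 hx) i
  have hmono : oneArmProb d (criticalProbI d) n ≤ oneArmProb d (criticalProbI d) (x i).natAbs :=
    DCT16.real_siteToBoundary_antitone _ hxin
  calc c * oneArmProb d (criticalProbI d) n ^ 2 ≤ c * oneArmProb d (criticalProbI d) (x i).natAbs ^ 2 :=
        mul_le_mul_of_nonneg_left (pow_le_pow_left₀ measureReal_nonneg hmono 2) hc.le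
    _ ≤ _ := hmain x i hmax hxi

/-- **(A2)□ ⇒ the lower hyperscaling inequality** (`p_c(ℤ^d)`, `d ≥ 2`, `2 ≤ s ≤ L`, `ϰ > 0`): there is `c > 0` with
`c · (2n+1)^d · π_{p_c}(n)² ≤ Σ_{z ∈ Λ(n)} τ_{p_c}(0, z)` for every `n` — the expected size of the cluster of the origin inside `Λ(n)` is
at least volume × (one-arm probability)², the lower half of `χ_n ≍ n^d π_n²` (Borgs–Chayes–Kesten–Spencer); the lead's V165 obtains
the same inequality from the annulus-blocking postulate instead.
[cite: BorgsChayesKestenSpencer1999, §1 (postulates)] [cite: Kesten1987, §1 (scaling relations)] [cite: BasuSapozhnikov2017ECP, §1 assumption (A2)] -/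
theorem exists_mul_card_mul_sq_oneArmProb_le_sum_tau_of_setToSetQuasiMultAspectAt (hd : 2 ≤ d) {s L : ℕ} {ϰ : ℝ}
    (h : SetToSetQuasiMultAspectAt d (criticalProbI d) s L ϰ) (hϰ : 0 < ϰ) (hs : 2 ≤ s) (hsL : s ≤ L) :
    ∃ c : ℝ, 0 < c ∧ ∀ n : ℕ,
      c * ((2 * (n : ℝ) + 1) ^ d * oneArmProb d (criticalProbI d) n ^ 2) ≤
        ∑ z ∈ box d n, tau d (criticalProbI d) 0 z := by
  obtain ⟨c, hc, hbox⟩ := exists_mul_sq_oneArmProb_le_tau_box_of_setToSetQuasiMultAspectAt hd h hϰ hs hsL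
  refine ⟨min c 1, lt_min hc one_pos, fun n => ?_⟩
  have hπ1 : oneArmProb d (criticalProbI d) n ≤ 1 := measureReal_le_one
  have hπ0 : 0 ≤ oneArmProb d (criticalProbI d) n := measureReal_nonneg
  have hterm : ∀ z ∈ box d n, min c 1 * oneArmProb d (criticalProbI d) n ^ 2 ≤ tau d (criticalProbI d) 0 z := by
    intro z hz
    by_cases hz0 : z = 0
    · subst hz0
      rw [tau_self]
      calc min c 1 * oneArmProb d (criticalProbI d) n ^ 2 ≤ 1 * 1 :=
            mul_le_mul (min_le_right _ _) (by nlinarith) (sq_nonneg _) zero_le_one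
        _ = 1 := one_mul 1
    · exact (mul_le_mul_of_nonneg_right (min_le_left c 1) (sq_nonneg _)).trans (hbox n z hz hz0)
  calc min c 1 * ((2 * (n : ℝ) + 1) ^ d * oneArmProb d (criticalProbI d) n ^ 2)
      = ∑ _z ∈ box d n, min c 1 * oneArmProb d (criticalProbI d) n ^ 2 := by
        rw [Finset.sum_const, card_box, nsmul_eq_mul]; push_cast; ring
    _ ≤ ∑ z ∈ box d n, tau d (criticalProbI d) 0 z := Finset.sum_le_sum hterm

end Rsw3

end Summit.CriticalPhenomena.PercolationContinuityZ3.Theorems
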